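import Literature.MathematicalPhysics.KineticTheory.HardSphereEulerProofs
import Literature.MathematicalPhysics.KineticTheory.HardSphereBBGKYLiouvilleFlow
import Literature.Analysis.FluidPDE.HardSphereAlexander

/-!
# Negative knowledge for `CorrectorPressureDecay` (stmt-AtomisticToContinuum-14135), I: frame facts (pure theorems)

From the standing disprover's `Cruxes/CorrectorPressureDecay/Disproof.lean` (refuter-cdisprove-stmt-AtomisticToContinuum-14135-0).
Def-free toolkit (flows, Gibbs invariance, Jensen floor, product formula, Gaussian reflections) that the negative
lemmas II–IV of the crux — and its provers — use:

* `nonempty_flow` — hard-sphere flows of `N + 1` spheres of reduced diameter `σ ∈ (0, 1/2)` on `𝕋³` EXIST for every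
  `N` (Alexander's theorem `HardSphereFlow.nonempty_torus_holds`, proved in the tree; `hsDiameter σ N ≤ σ < 1/2`), so the
  crux's `∀ Φ` clauses are instantiable and its negative lemmas are unconditional;
* `measurePreserving_flow_localGibbsLaw` — the ZERO-DRIFT global Gibbs law `localGibbsLaw σ a 0 θ N Φ` (constant
  profiles) is invariant under every `Φ.flow t` (the `u₀ = 0` case of the route's support item HomogeneousInvariance,
  stmt-9621): Liouville preservation (structure axiom) + energy conservation on the good set
  (`HardSphereFlow.configEnergy_flow`) + `good ⊆ D_ε`; the density is a function of the kinetic energy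
  (`tensorPow_localGibbsProfile_const`);
* `ofReal_exp_le_lintegral_exp_sub_coboundary` — Jensen: under a `T`-invariant probability law a bounded coboundary
  `s (W∘T − W)` has mean zero, hence `e^c ≤ ∫ exp(c − s(W∘T − W))`: a corrector never lowers the exponential moment
  of a constant;
* `lintegral_prod_vel_localGibbsMeasure`, `lintegral_exp_sum_vel_localGibbsMeasure` — PRODUCT FORMULA under the
  constant-profile global Gibbs law (`σ ≤ 1/2`): `∫ exp(Σᵢ ψ(vᵢ)) dG_N = (∫ e^ψ dN(u₀,θ))^{N+1}`;
* `integral_stdGaussian_eq_zero_of_odd`, `coordFlip_apply`, `stdGaussian_pos_of_isOpen`, `quadWeight_eq` — linear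
  isometries preserve the standard Gaussian (odd integrands vanish), coordinate sign flips, positivity on open sets,
  and the quadratic weight `c₀ + ⟪b,v⟫ + c₂|v|²` in coordinates.
-/

noncomputable section

open MeasureTheory ProbabilityTheory Set Filter Topology
open scoped ENNReal

namespace Summit.AtomisticToContinuum.HydrodynamicLimit.Theorems.CorrectorPressureDecayNegative

open Literature.MathematicalPhysics.KineticTheory (T3 V3 hsDiameter localGibbsLaw localGibbsMeasure
  localGibbsProfile)
open Literature.Analysis.FluidPDE (HardSphereFlow Config configEnergy)

/-- **Flows exist**: for `0 < σ < 1/2` and every `N` the type of hard-sphere flows of `N+1` spheres of diameter `hsDiameter σ N` on `𝕋³` is inhabited (Alexander's theorem on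
`𝕋³`, `HardSphereFlow.nonempty_torus_holds`, with `0 < hsDiameter σ N ≤ σ < 1/2`). [cite: Alexander1975] -/
theorem nonempty_flow {σ : ℝ} (hσ : 0 < σ) (hσ' : σ < 2⁻¹) (N : ℕ) :
    Nonempty (HardSphereFlow (Literature.Analysis.FluidPDE.Torus.geometry (Fin 3)) (hsDiameter σ N) (N + 1)) :=
  Literature.Analysis.FluidPDE.HardSphereFlow.nonempty_torus_holds (d := Fin 3)
    (Literature.MathematicalPhysics.KineticTheory.hsDiameter_pos hσ N)
    ((Literature.MathematicalPhysics.KineticTheory.hsDiameter_le hσ.le N).trans_lt hσ') (N + 1)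

/-- The tensor power of a constant zero-drift local Gibbs profile is a function of the kinetic energy:
`∏ᵢ a M_{1,0,θ}(vᵢ) = (a (2πθ)^{-3/2})^{n} exp(−E(z)/θ)`, `E = ½∑|vᵢ|²`. [folklore] -/
theorem tensorPow_localGibbsProfile_const (a θ : ℝ) (n : ℕ) (z : Config n (Fin 3) T3) :
    Literature.Analysis.FluidPDE.tensorPow n (localGibbsProfile (fun _ => a) (fun _ => (0 : V3)) (fun _ => θ)) z =
      (a * (2 * Real.pi * θ) ^ (-(3 : ℝ) / 2)) ^ n * Real.exp (-configEnergy z / θ) := by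
  have hE : ∑ i, -‖(z i).2‖ ^ 2 / (2 * θ) = -configEnergy z / θ := by
    simp only [configEnergy, Finset.mul_sum, neg_div, Finset.sum_neg_distrib, Finset.sum_div]
    congr 1
    refine Finset.sum_congr rfl fun i _ => ?_
    ring
  simp only [Literature.Analysis.FluidPDE.tensorPow, localGibbsProfile,
    Literature.Analysis.FluidPDE.localMaxwellian, sub_zero, one_mul, finrank_euclideanSpace,
    Fintype.card_fin, Nat.cast_ofNat]
  calc ∏ i, a * ((2 * Real.pi * θ) ^ (-(3 : ℝ) / 2) * Real.exp (-‖(z i).2‖ ^ 2 / (2 * θ)))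
      = ∏ i, ((a * (2 * Real.pi * θ) ^ (-(3 : ℝ) / 2)) * Real.exp (-‖(z i).2‖ ^ 2 / (2 * θ))) := by
        refine Finset.prod_congr rfl fun i _ => ?_
        ring
    _ = (a * (2 * Real.pi * θ) ^ (-(3 : ℝ) / 2)) ^ n * ∏ i, Real.exp (-‖(z i).2‖ ^ 2 / (2 * θ)) := by
        rw [Finset.prod_mul_distrib, Finset.prod_const, Finset.card_univ, Fintype.card_fin]
    _ = _ := by rw [← Real.exp_sum, hE]

/-- **The zero-drift global Gibbs law is invariant under every hard-sphere flow** (HomogeneousInvariance, case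
`u₀ = 0`): each `Φ.flow t` preserves `G_N = localGibbsLaw σ a 0 θ N Φ`. Proof: `G_N = ρ · liouville` with `ρ` a
function of the kinetic energy and of membership in `D_ε`; on the (conull, invariant) good set both are preserved
(`HardSphereFlow.configEnergy_flow`, `good ⊆ D_ε`), and `liouville` is preserved (structure axiom).
[cite: CIP1994, §4.2] -/
theorem measurePreserving_flow_localGibbsLaw {σ : ℝ} (a θ : ℝ) (N : ℕ)
    (Φ : HardSphereFlow (Literature.Analysis.FluidPDE.Torus.geometry (Fin 3)) (hsDiameter σ N) (N + 1)) (t : ℝ) :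
    MeasurePreserving (Φ.flow t) (localGibbsLaw σ (fun _ => a) (fun _ => 0) (fun _ => θ) N Φ)
      (localGibbsLaw σ (fun _ => a) (fun _ => 0) (fun _ => θ) N Φ) := by
  set L := Literature.Analysis.FluidPDE.liouville (Literature.Analysis.FluidPDE.Torus.geometry (Fin 3)) (N + 1)
    (hsDiameter σ N) with hL
  set ρ : Config (N + 1) (Fin 3) T3 → ℝ≥0∞ := fun z => ENNReal.ofReal (Literature.Analysis.FluidPDE.canonicalDensity
    (Literature.Analysis.FluidPDE.Torus.geometry (Fin 3)) (hsDiameter σ N) (N + 1)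
    (localGibbsProfile (fun _ => a) (fun _ => (0 : V3)) (fun _ => θ)) z) with hρ
  have hG : localGibbsLaw σ (fun _ => a) (fun _ => 0) (fun _ => θ) N Φ = L.withDensity ρ := rfl
  have hρm : Measurable ρ :=
    (Literature.MathematicalPhysics.KineticTheory.measurable_canonicalDensity _ _
      (Literature.MathematicalPhysics.KineticTheory.measurable_localGibbsProfile continuous_const
        continuous_const continuous_const)).ennreal_ofReal
  have hinv : ∀ z ∈ Φ.good, ρ (Φ.flow t z) = ρ z := by
    intro z hz
    have hz' : Φ.flow t z ∈ Φ.good := Φ.mapsTo_good t hz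
    simp only [hρ, Literature.Analysis.FluidPDE.canonicalDensity, indicator_of_mem (Φ.good_subset hz),
      indicator_of_mem (Φ.good_subset hz'), tensorPow_localGibbsProfile_const, Φ.configEnergy_flow hz t]
  refine ⟨Φ.measurable_flow t, ?_⟩
  ext A hA
  rw [Measure.map_apply (Φ.measurable_flow t) hA, hG, withDensity_apply _ (Φ.measurable_flow t hA),
    withDensity_apply _ hA, ← lintegral_indicator (Φ.measurable_flow t hA), ← lintegral_indicator hA]
  have hae : (fun z => (Φ.flow t ⁻¹' A).indicator ρ z) =ᵐ[L] fun z => (A.indicator ρ) (Φ.flow t z) := by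
    filter_upwards [Φ.ae_mem_good] with z hz
    by_cases h : Φ.flow t z ∈ A
    · rw [indicator_of_mem (show z ∈ Φ.flow t ⁻¹' A from h), indicator_of_mem h, hinv z hz]
    · rw [indicator_of_notMem (show z ∉ Φ.flow t ⁻¹' A from h), indicator_of_notMem h]
  rw [lintegral_congr_ae hae, (Φ.measurePreserving t).lintegral_comp (hρm.indicator hA)]

/-- **Jensen + invariance**: for a probability measure `μ` preserved by `T`, a bounded measurable `W` and constants
`c, s`, `e^c ≤ ∫ exp(c − s (W∘T − W)) dμ` — the coboundary has mean zero, and `exp` is convex. [folklore] -/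
theorem ofReal_exp_le_lintegral_exp_sub_coboundary {X : Type*} [MeasurableSpace X] {μ : Measure X}
    [IsProbabilityMeasure μ] {T : X → X} (hT : MeasurePreserving T μ μ) {W : X → ℝ} (hWm : Measurable W)
    {C : ℝ} (hC : ∀ z, |W z| ≤ C) (c s : ℝ) :
    ENNReal.ofReal (Real.exp c) ≤ ∫⁻ z, ENNReal.ofReal (Real.exp (c - s * (W (T z) - W z))) ∂μ := by
  have hWTm : Measurable fun z => W (T z) := hWm.comp hT.measurable
  have hDm : Measurable fun z => c - s * (W (T z) - W z) :=
    measurable_const.sub (measurable_const.mul (hWTm.sub hWm))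
  have hWint : Integrable W μ :=
    (integrable_const C).mono' hWm.aestronglyMeasurable (ae_of_all _ fun z => by
      simpa [Real.norm_eq_abs] using hC z)
  have hWTint : Integrable (fun z => W (T z)) μ :=
    (integrable_const C).mono' hWTm.aestronglyMeasurable (ae_of_all _ fun z => by
      simpa [Real.norm_eq_abs] using hC (T z))
  have hDint : Integrable (fun z => c - s * (W (T z) - W z)) μ :=
    (integrable_const c).sub ((hWTint.sub hWint).const_mul s)
  have hbd : ∀ z, |c - s * (W (T z) - W z)| ≤ |c| + |s| * (C + C) := by
    intro z
    calc |c - s * (W (T z) - W z)| ≤ |c| + |s * (W (T z) - W z)| := abs_sub _ _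
      _ = |c| + |s| * |W (T z) - W z| := by rw [abs_mul]
      _ ≤ |c| + |s| * (C + C) := by
          gcongr
          exact (abs_sub _ _).trans (add_le_add (hC _) (hC _))
  have hexpint : Integrable (fun z => Real.exp (c - s * (W (T z) - W z))) μ := by
    refine (integrable_const (Real.exp (|c| + |s| * (C + C)))).mono'
      (Real.continuous_exp.measurable.comp hDm).aestronglyMeasurable (ae_of_all _ fun z => ?_)
    rw [Real.norm_eq_abs, abs_of_pos (Real.exp_pos _)]
    exact Real.exp_le_exp.2 ((le_abs_self _).trans (hbd z))
  have hWT : ∫ z, W (T z) ∂μ = ∫ z, W z ∂μ := by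
    rw [← integral_map hT.measurable.aemeasurable hWm.aestronglyMeasurable, hT.map_eq]
  have hI2 : Integrable (fun z => s * (W (T z) - W z)) μ := (hWTint.sub hWint).const_mul s
  have hmean : ∫ z, (c - s * (W (T z) - W z)) ∂μ = c := by
    have h1 : ∫ z, (c - s * (W (T z) - W z)) ∂μ = (∫ _z, (c : ℝ) ∂μ) - ∫ z, s * (W (T z) - W z) ∂μ :=
      integral_sub (integrable_const c) hI2
    have h2 : ∫ z, s * (W (T z) - W z) ∂μ = s * ((∫ z, W (T z) ∂μ) - ∫ z, W z ∂μ) := by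
      rw [integral_const_mul, integral_sub hWTint hWint]
    rw [h1, h2, hWT, sub_self, mul_zero, sub_zero]
    simp
  have hJ := ConvexOn.map_integral_le (convexOn_exp) Real.continuous_exp.continuousOn isClosed_univ
    (ae_of_all _ fun z => mem_univ _) hDint hexpint
  rw [hmean] at hJ
  calc ENNReal.ofReal (Real.exp c) ≤ ENNReal.ofReal (∫ z, Real.exp (c - s * (W (T z) - W z)) ∂μ) :=
        ENNReal.ofReal_le_ofReal hJ
    _ = ∫⁻ z, ENNReal.ofReal (Real.exp (c - s * (W (T z) - W z))) ∂μ :=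
        ofReal_integral_eq_lintegral_ofReal hexpint (ae_of_all _ fun z => (Real.exp_pos _).le)


/-! ## Product formula for one-body velocity functionals under the global Gibbs law -/

section Static

open Literature.MathematicalPhysics.KineticTheory

/-- **Product formula.** Under the constant-profile Gibbs law (`σ ≤ 1/2`, so that it is a probability measure)
a product of one-body VELOCITY factors integrates to the `(N+1)`-st power of the one-body Gaussian integral:
positions and velocities are independent and the velocities are i.i.d. `N(u₀, θ)` (disintegration
`lintegral_localGibbsMeasure` of the tree + Tonelli on `(ℝ³)^{N+1}`). [folklore] -/
theorem lintegral_prod_vel_localGibbsMeasure {a θ : ℝ} (ha : 0 < a) (hθ : 0 < θ) (u₀ : V3) {σ : ℝ}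
    (hσ2 : σ ≤ 1 / 2) (N : ℕ) {f : V3 → ℝ≥0∞} (hf : Measurable f) :
    ∫⁻ z, ∏ i, f (z i).2 ∂(localGibbsMeasure σ (fun _ => a) (fun _ => u₀) (fun _ => θ) N) =
      (∫⁻ w, f w ∂(gaussMeasure u₀ θ)) ^ (N + 1) := by
  haveI := isProbabilityMeasure_localGibbsMeasure (a₀ := fun _ => a) (u₀ := fun _ => u₀) (θ₀ := fun _ => θ)
    continuous_const continuous_const continuous_const (fun _ => ha) (fun _ => hθ) hσ2 N
  have hG : Measurable fun z : Config (N + 1) (Fin 3) T3 => ∏ i, f (z i).2 :=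
    Finset.measurable_prod _ fun i _ => hf.comp (measurable_pi_apply i).snd
  rw [lintegral_localGibbsMeasure continuous_const continuous_const continuous_const (fun _ => ha.le)
    (fun _ => hθ) σ N hG]
  have hinner : ∀ x : Fin (N + 1) → T3,
      ∫⁻ v, (∏ i, f (zipConfig (x, v) i).2) ∂velMeasure (fun _ => u₀) (fun _ => θ) x =
        (∫⁻ w, f w ∂(gaussMeasure u₀ θ)) ^ (N + 1) := by
    intro x
    simp only [zipConfig_apply]
    rw [velMeasure, lintegral_fintype_prod_eq_prod' _ (fun _ => hf), Finset.prod_const, Finset.card_univ,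
      Fintype.card_fin]
  simp_rw [hinner]
  have hρm : Measurable fun x : Fin (N + 1) → T3 => ENNReal.ofReal
      ((Literature.Analysis.FluidPDE.canonicalPartition (Literature.Analysis.FluidPDE.Torus.geometry (Fin 3))
        (hsDiameter σ N) (N + 1) (localGibbsProfile (fun _ => a) (fun _ => u₀) (fun _ => θ)))⁻¹ *
        posWeight (fun _ => a) (hsDiameter σ N) (N + 1) x) :=
    (measurable_const.mul (measurable_posWeight continuous_const _ _)).ennreal_ofReal
  rw [lintegral_mul_const _ hρm, lintegral_posWeight_eq_one continuous_const continuous_const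
    continuous_const (fun _ => ha.le) (fun _ => hθ) σ N, one_mul]

/-- **Exponential moments of one-body velocity sums factorise**:
`∫ exp(∑ᵢ ψ(vᵢ)) dG_N = (∫ e^{ψ} dN(u₀,θ))^{N+1}`. With `ψ = 2φ̄ g((· − u₀)/√θ)` this is the EXACT value of the
crux's defect clause at `W = 0`, `φ ≡ φ̄`: pressure `(N+1) log E_γ e^{2φ̄ g}`. [folklore] -/
theorem lintegral_exp_sum_vel_localGibbsMeasure {a θ : ℝ} (ha : 0 < a) (hθ : 0 < θ) (u₀ : V3) {σ : ℝ}
    (hσ2 : σ ≤ 1 / 2) (N : ℕ) {ψ : V3 → ℝ} (hψ : Measurable ψ) :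
    ∫⁻ z, ENNReal.ofReal (Real.exp (∑ i, ψ (z i).2))
        ∂(localGibbsMeasure σ (fun _ => a) (fun _ => u₀) (fun _ => θ) N) =
      (∫⁻ w, ENNReal.ofReal (Real.exp (ψ w)) ∂(gaussMeasure u₀ θ)) ^ (N + 1) := by
  have h : ∀ z : Config (N + 1) (Fin 3) T3, ENNReal.ofReal (Real.exp (∑ i, ψ (z i).2)) =
      ∏ i, ENNReal.ofReal (Real.exp (ψ (z i).2)) := by
    intro z
    rw [Real.exp_sum, ENNReal.ofReal_prod_of_nonneg fun i _ => (Real.exp_pos _).le]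
  simp_rw [h]
  exact lintegral_prod_vel_localGibbsMeasure ha hθ u₀ hσ2 N
    (Real.continuous_exp.measurable.comp hψ).ennreal_ofReal

/-- The unit Gaussian with zero mean is the standard Gaussian. [folklore] -/
theorem gaussMeasure_zero_one : gaussMeasure (0 : V3) 1 = stdGaussian V3 := by
  have : (fun w : V3 => (0 : V3) + Real.sqrt 1 • w) = id := by
    funext w
    simp
  rw [gaussMeasure, this, Measure.map_id]

/-! ## Gaussian reflections, positivity, coordinates -/

/-- A function odd under a linear isometry of `ℝ³` has zero standard-Gaussian integral (`stdGaussian_map`). [folklore] -/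
theorem integral_stdGaussian_eq_zero_of_odd (R : V3 ≃ₗᵢ[ℝ] V3) {f : V3 → ℝ} (hf : ∀ v, f (R v) = -f v) :
    ∫ v, f v ∂stdGaussian V3 = 0 := by
  have hR : MeasurePreserving R (stdGaussian V3) (stdGaussian V3) :=
    ⟨R.continuous.measurable, stdGaussian_map R⟩
  have h1 : ∫ v, f (R v) ∂stdGaussian V3 = ∫ v, f v ∂stdGaussian V3 :=
    hR.integral_comp R.toHomeomorph.measurableEmbedding f
  simp_rw [hf, integral_neg] at h1
  linarith

/-- Invariance of the standard-Gaussian integral under a linear isometry of `ℝ³`. [folklore] -/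
theorem integral_stdGaussian_comp (R : V3 ≃ₗᵢ[ℝ] V3) (f : V3 → ℝ) :
    ∫ v, f (R v) ∂stdGaussian V3 = ∫ v, f v ∂stdGaussian V3 :=
  (show MeasurePreserving R (stdGaussian V3) (stdGaussian V3) from
    ⟨R.continuous.measurable, stdGaussian_map R⟩).integral_comp R.toHomeomorph.measurableEmbedding f

/-- The coordinate sign flip `v ↦ (…, −v_k, …)` written with `LinearIsometryEquiv.piLpCongrRight`, evaluated. [folklore] -/
theorem coordFlip_apply (k : Fin 3) (v : V3) (i : Fin 3) :
    (LinearIsometryEquiv.piLpCongrRight 2 fun j : Fin 3 =>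
        if j = k then LinearIsometryEquiv.neg ℝ else LinearIsometryEquiv.refl ℝ ℝ) v i =
      if i = k then -v i else v i := by
  simp only [LinearIsometryEquiv.piLpCongrRight_apply, PiLp.toLp_apply]
  split_ifs <;> simp

/-- `volume ≪ stdGaussian` on `ℝ³` (everywhere-positive Maxwellian density,
`stdGaussian_eq_withDensity_globalMaxwellian_holds`). [folklore] -/
theorem volume_absolutelyContinuous_stdGaussian : (volume : Measure V3) ≪ stdGaussian V3 := by
  rw [show stdGaussian V3 = (volume : Measure V3).withDensity
      (fun v => ENNReal.ofReal (Literature.Analysis.FluidPDE.globalMaxwellian v)) from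
    Literature.Analysis.FluidPDE.stdGaussian_eq_withDensity_globalMaxwellian_holds]
  exact withDensity_absolutelyContinuous'
    (Literature.Analysis.FluidPDE.continuous_globalMaxwellian.measurable.ennreal_ofReal.aemeasurable)
    (ae_of_all _ fun v => (ENNReal.ofReal_pos.2 (Literature.Analysis.FluidPDE.globalMaxwellian_pos v)).ne')

/-- Open nonempty sets have positive standard-Gaussian mass. [folklore] -/
theorem stdGaussian_pos_of_isOpen {U : Set V3} (hU : IsOpen U) (hne : U.Nonempty) : 0 < stdGaussian V3 U :=
  pos_iff_ne_zero.2 fun h0 => (hU.measure_pos volume hne).ne' (volume_absolutelyContinuous_stdGaussian h0)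

/-- A point of `ℝ³` with prescribed squared norm `c ≥ 0`. [folklore] -/
theorem exists_norm_sq_eq {c : ℝ} (hc : 0 ≤ c) : ∃ v : V3, ‖v‖ ^ 2 = c := by
  obtain ⟨e, he⟩ := exists_ne (0 : V3)
  have hepos : 0 < ‖e‖ := norm_pos_iff.2 he
  refine ⟨(Real.sqrt c / ‖e‖) • e, ?_⟩
  rw [norm_smul, Real.norm_eq_abs, abs_of_nonneg (by positivity), div_mul_cancel₀ _ hepos.ne',
    Real.sq_sqrt hc]

/-- `e^y + e^{-y} ≥ 2 + y²/2`. [folklore] -/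
theorem two_add_sq_div_two_le_exp_add_exp_neg (y : ℝ) : 2 + y ^ 2 / 2 ≤ Real.exp y + Real.exp (-y) := by
  rcases le_total 0 y with hy | hy
  · have h1 := Real.quadratic_le_exp_of_nonneg hy
    have h2 := Real.add_one_le_exp (-y)
    linarith
  · have h1 := Real.quadratic_le_exp_of_nonneg (neg_nonneg.2 hy)
    have h2 := Real.add_one_le_exp y
    rw [neg_sq] at h1
    linarith

/-- The quadratic weight `c₀ + ⟪b, v⟫ + c₂|v|²` of the crux's orthogonality clause in coordinates (norm kept). [folklore] -/
theorem quadWeight_eq (c₀ c₂ : ℝ) (b v : V3) :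
    c₀ + inner ℝ b v + c₂ * ‖v‖ ^ 2 = c₀ + (b 0 * v 0 + b 1 * v 1 + b 2 * v 2) + c₂ * ‖v‖ ^ 2 := by
  rw [real_inner_comm, EuclideanSpace.inner_eq_star_dotProduct]
  simp [dotProduct, Fin.sum_univ_three]

/-- Measurability of the kinetic energy on the torus phase space. [folklore] -/
theorem measurable_configEnergy (n : ℕ) : Measurable (configEnergy : Config n (Fin 3) T3 → ℝ) := by
  unfold configEnergy
  exact measurable_const.mul (Finset.measurable_sum _ fun i _ => ((measurable_pi_apply i).snd.norm.pow_const 2))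

end Static

end Summit.AtomisticToContinuum.HydrodynamicLimit.Theorems.CorrectorPressureDecayNegative
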